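import Summits.QuantumFields.YangMills.Theorems.TemperedCurvatureMoments.Negative.TieLoadBearing
import Summits.QuantumFields.YangMills.Theorems.IsotropyFromPowerCountingCurvatureDensitiesTameSector

/-!
# `TemperedCurvatureMoments` (T, stmt-QuantumFields-17721) — negative side IV: line `Sketch`'s intermediate target
# MESO(n) holds on the eventually-tame sector (no certified inhabitant contradicts the mesoscopic reduction)

Disprover (cdisprove) support file for the item `IsotropyFromPowerCounting.TemperedCurvatureMoments` (T) and the
registered skeleton `Cruxes/TemperedCurvatureMoments/Lines/Sketch.lean` (line `Sketch`, card markov-shielding).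

The line proves T through the MESOSCOPIC bound MESO(n) (hypothesis `hmeso` of the registered `stub_temperedOfMeso`,
verbatim below): `∃ C N, 0 < C ∧ ∀ s ∈ (0,1], ∃ k₀, ∀ k ≥ k₀`, at every multi-site of the INNER HALF-BOX with
pairwise physical separations `≥ s`, `|c_kⁿ W_k(x)| ≤ C s^{-N}`.  MESO(n) is STRONGER than the degree-`n`
conclusion of T (a uniform bound with no growth allowance at large `‖a_k x‖`), so the sector theorems for T
(`temperedApproximants_of_eventually_tame`) do not cover it.  This file certifies that MESO(n), too, holds on every
EVENTUALLY-TAME scheme — tie + `∃ B, ∀ᶠ k, β_k = 0 ∨ |c_k| ≤ B` — with `N = 0` and `k₀` independent of `s`: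

* `meso_of_eventually_tame` — at zero-coupling steps the true density on torus-distinct sites is the constant
  `κ_kⁿ` (`κ_k` bounded by the degree-one tie), WHATEVER `c_k, m_k`; at bounded-`c` steps it is bounded by
  `(2BM + K)ⁿ`; separated sites of the inner half-box are injective sites of the box.

So, like T itself (`temperedCurvatureMoments_iff_wildSector`), the line's intermediate statement can only fail on
the wild sector `∀ B, ∃ᶠ k, β_k ≠ 0 ∧ B < |c_k|`; the certified regimes listed in the docstring of the lead's
`stub_shieldedMomentBound` are consistent with the whole chain MESO ⟸ CH.
-/

noncomputable section

-- Mathlib's `SimplexCategory` instance `Fintype (Fin (x.len + 1))` matches `Fintype (Fin 4)` (tree-known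
-- workaround, cf. the imported support files).
attribute [-instance] SimplexCategory.instFintypeToTypeOrderHomFinHAddNatLenOfNat

namespace Summit.QuantumFields.YangMills.Theorems.TemperedCurvatureMoments.Negative

open scoped BigOperators SchwartzMap
open MeasureTheory Filter Topology
open Literature.MathematicalPhysics.QuantumLattice Literature.MathematicalPhysics.AQFT
  Literature.MathematicalPhysics.QuantumFieldTheory
open Literature.Probability.LatticeModels (box Site Torus.proj mem_box)
open Summit.QuantumFields.YangMills.Theorems.NPointIsotropy.Negative (E4)
open Summit.QuantumFields.YangMills.Theorems.CurvatureBoostCovariance.Negative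
  (Tie haarTraceRe proj_injOn_box eventually_lt_side)
open Summit.QuantumFields.YangMills.Theorems.OSLegsFromFemtoAndGap (torusMoment)
open Summit.QuantumFields.YangMills.Theorems.SoftKernelBoostCovariance.Sketch
  (eventually_abs_renormalisedMean_le abs_trueDensity_le)
open Summit.QuantumFields.YangMills.Theorems.CurvatureDensities
  (torusMoment_zero_coupling wilsonTorusMean_zero_coupling)

variable {G : Type} [Group G] [TopologicalSpace G] [IsTopologicalGroup G] [CompactSpace G]
  [MeasurableSpace G] [BorelSpace G]

omit [Group G] [TopologicalSpace G] [IsTopologicalGroup G] [CompactSpace G] [MeasurableSpace G]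
  [BorelSpace G] in
/-- The inner half-box is inside the box. -/
theorem mem_box_of_mem_box_half {L : ℕ} {y : Site 4} (hy : y ∈ box 4 (L / 2)) : y ∈ box 4 L := by
  rw [mem_box] at hy ⊢
  intro i
  obtain ⟨h1, h2⟩ := hy i
  have : ((L / 2 : ℕ) : ℤ) ≤ (L : ℤ) := by exact_mod_cast Nat.div_le_self L 2
  constructor <;> omega

omit [Group G] [TopologicalSpace G] [IsTopologicalGroup G] [CompactSpace G] [MeasurableSpace G]
  [BorelSpace G] in
/-- Separated multi-sites are injective. -/
theorem injective_of_separated {n : ℕ} {a s : ℝ} (hs : 0 < s) (x : Fin n → Site 4)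
    (hsep : ∀ i j, i ≠ j → s ≤ ‖a • siteToE (x i) - a • siteToE (x j)‖) : Function.Injective x := by
  intro i j hij
  by_contra hne
  have h := hsep i j hne
  rw [hij, sub_self, norm_zero] at h
  exact absurd h (not_le.2 hs)

/-- **MESO(n) on the eventually-tame sector** (the hypothesis `hmeso` of the registered `stub_temperedOfMeso` of
line `Sketch`, verbatim).  If `S₁` is tied to `(r, sch)` and for some `B`, for all large `k`, `β_k = 0` or
`|c_k| ≤ B`, then for every `n ≥ 1` the true renormalised density `c_kⁿ W_k` is bounded by a CONSTANT (so `N = 0`,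
`k₀` independent of `s`) at every separated multi-site of the inner half-box. -/
theorem meso_of_eventually_tame (r : LatticeRep G) (sch : SpeciesScheme (YMSpecies G))
    (S₁ : SchwingerFamily E4) (htie : Tie r sch S₁)
    (h : ∃ B : ℝ, ∀ᶠ k in atTop, sch.β k = 0 ∨ |sch.c r.curvature k| ≤ B) {n : ℕ} (hn : 0 < n) :
    ∃ (C : ℝ) (N : ℕ), 0 < C ∧ ∀ s : ℝ, 0 < s → s ≤ 1 → ∃ k₀ : ℕ, ∀ k : ℕ, k₀ ≤ k →
      ∀ x : Fin n → Site 4, (∀ i, x i ∈ box 4 (sch.L k / 2)) →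
        (∀ i j, i ≠ j → s ≤ ‖sch.a k • siteToE (x i) - sch.a k • siteToE (x j)‖) →
        |(sch.c r.curvature k) ^ n *
            torusMoment r.ρ (sch.β k) (sch.L k) r.curvature.F (sch.m r.curvature k) x| ≤ C * s⁻¹ ^ N := by
  obtain ⟨B, hB⟩ := h
  obtain ⟨k₃, hk₃⟩ := eventually_atTop.1 hB
  obtain ⟨M, hM⟩ := r.curvature.bounded
  obtain ⟨K, hK⟩ := eventually_abs_renormalisedMean_le r sch S₁ htie
  obtain ⟨k₁, hk₁⟩ := eventually_atTop.1 hK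
  obtain ⟨k₂, hk₂⟩ := eventually_atTop.1 (eventually_lt_side sch n)
  refine ⟨|2 * B * M + K| ^ n + |K| ^ n + 1, 0, by positivity, fun s hs _ => ⟨max (max k₁ k₂) k₃, ?_⟩⟩
  intro k hk x hx hsep
  have hk1 : k₁ ≤ k := ((le_max_left _ _).trans (le_max_left _ _)).trans hk
  have hk2 : k₂ ≤ k := ((le_max_right _ _).trans (le_max_left _ _)).trans hk
  have hk3 : k₃ ≤ k := (le_max_right _ _).trans hk
  have hKn : 0 ≤ |K| ^ n := pow_nonneg (abs_nonneg _) n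
  have hBn : 0 ≤ |2 * B * M + K| ^ n := pow_nonneg (abs_nonneg _) n
  have hx' : ∀ i, x i ∈ box 4 (sch.L k) := fun i => mem_box_of_mem_box_half (hx i)
  have hxinj : Function.Injective x := injective_of_separated hs x hsep
  simp only [pow_zero, mul_one]
  rcases hk₃ k hk3 with hβ | hc
  · have hside : n < 2 * sch.L k + 1 := hk₂ k hk2
    have hL : 0 < sch.L k := by omega
    have hinj' : Function.Injective fun i => Torus.proj (2 * sch.L k + 1) (x i) :=
      fun i j hij => hxinj (proj_injOn_box (sch.L k) (hx' i) (hx' j) hij)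
    have hκ := hk₁ k hk1
    rw [hβ, wilsonTorusMean_zero_coupling r hL] at hκ
    rw [hβ, torusMoment_zero_coupling r (sch.L k) _ x hinj' hside, ← mul_pow, abs_pow]
    calc |sch.c r.curvature k * (6 * haarTraceRe r.ρ - sch.m r.curvature k)| ^ n
        ≤ |K| ^ n := pow_le_pow_left₀ (abs_nonneg _) (hκ.trans (le_abs_self K)) n
      _ ≤ |2 * B * M + K| ^ n + |K| ^ n + 1 := by linarith
  · calc |sch.c r.curvature k ^ n *
            torusMoment r.ρ (sch.β k) (sch.L k) r.curvature.F (sch.m r.curvature k) x|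
        ≤ (2 * B * M + K) ^ n := abs_trueDensity_le r sch hM k hc (hk₁ k hk1) x
      _ ≤ |2 * B * M + K| ^ n := by rw [← abs_pow]; exact le_abs_self _
      _ ≤ |2 * B * M + K| ^ n + |K| ^ n + 1 := by linarith

/-- **Corollary: MESO(n) on every scheme at zero coupling eventually, whatever `c_k, m_k`.** -/
theorem meso_of_eventually_zero_coupling (r : LatticeRep G) (sch : SpeciesScheme (YMSpecies G))
    (S₁ : SchwingerFamily E4) (htie : Tie r sch S₁) (hβ : ∀ᶠ k in atTop, sch.β k = 0) {n : ℕ} (hn : 0 < n) :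
    ∃ (C : ℝ) (N : ℕ), 0 < C ∧ ∀ s : ℝ, 0 < s → s ≤ 1 → ∃ k₀ : ℕ, ∀ k : ℕ, k₀ ≤ k →
      ∀ x : Fin n → Site 4, (∀ i, x i ∈ box 4 (sch.L k / 2)) →
        (∀ i j, i ≠ j → s ≤ ‖sch.a k • siteToE (x i) - sch.a k • siteToE (x j)‖) →
        |(sch.c r.curvature k) ^ n *
            torusMoment r.ρ (sch.β k) (sch.L k) r.curvature.F (sch.m r.curvature k) x| ≤ C * s⁻¹ ^ N :=
  meso_of_eventually_tame r sch S₁ htie ⟨0, hβ.mono fun _ hk => Or.inl hk⟩ hn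

end Summit.QuantumFields.YangMills.Theorems.TemperedCurvatureMoments.Negative

end
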